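import Literature.NumberTheory.EllipticCurves.HondaStrongIsomorphismMultiplicativeProofs
import Literature.NumberTheory.EllipticCurves.StableCyclicSubgroupTransportProofs
import Literature.NumberTheory.EllipticCurves.RootNumberTwistProofs
import Literature.NumberTheory.EllipticCurves.LFunctionPrimeCoeff
import Literature.NumberTheory.EllipticCurves.PAdicBSDSplitMultiplicativeProofs
import Literature.NumberTheory.EllipticCurves.SzpiroLocalDataProofs
import Literature.NumberTheory.EllipticCurves.OrdinaryPrimesProofs
import Literature.NumberTheory.EllipticCurves.Rank1Residual.Predicates
import HarnessLib

/-!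
# BSD rank-≤1 residual cell: reduction data, (ram) and irreducibility of `E[p]` READ OFF AN INTEGER
# MODEL in the kernel (the prime-indexed predicates of the cell from `integralModelInt W = E₀`)

HONEST FRAMING (cell `b2b-bsdres-*`, verbatim): prove what is provable now; shrink each hard class
to its core with data; no claim beyond stated classes; COMBINATION classes are deleted from
PUBLISHED theorems only, the CONSTRUCTION-shaped remainder is typed; this is not "finishing BSD".

Theorems only (no definition, no named fact). Purpose: the per-pair HYPOTHESIS CERTIFICATES of the
cell's certificate records (unit `b2b-bsdres-x11c`: `Record.Claim` conjuncts `Mult`, split /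
non-split, `¬ Semistable`, `Ram`, `Irr`) are statements about an explicit globally minimal integer
model; this file derives each of them IN THE KERNEL from decidable integer data, for ANY globally
minimal elliptic `W / ℚ` whose integral model is a given `E₀ : WeierstrassCurve ℤ`
(`integralModelInt W = E₀`; for a literal integer equation this is `integralModelInt_eq_of_map_eq`):

* `hasMultiplicativeReductionAtPrime_of_intModel` — `p ∣ Δ(E₀)`, `p ∤ c₄(E₀)` ⟹ `Mult W p`
  (Silverman VII.5.1(b); tree: `hasMultiplicativeReductionAt_of_dvd_of_not_dvd` + the `𝓞 ℚ`-place
  bridge);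
* `hasSplitMultiplicativeReductionAtPrime_of_intModel_of_root` /
  `not_hasSplitMultiplicativeReductionAtPrime_of_intModel_of_noroot` — at such `p`, split iff the
  node-tangent quadratic `c₄T² + a₁c₄T − (54b₆ − 3b₂b₄ + a₂c₄)` of `E₀` has a root mod `p`
  (tree: `hasSplitMultiplicativeReductionAt_iff_splits`; a quadratic over a field splits iff it has
  a root);
* `not_semistable_of_intModel` — `q ∣ Δ(E₀)`, `q ∣ c₄(E₀)` ⟹ additive at `q` ⟹ `¬ Semistable W`
  (Silverman VII.5.1(c); tree: `hasAdditiveReductionAt_iff_of_isMinimalAt`);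
* `ram_of_intModel` — a prime `ℓ ≠ p` with `ℓ ∣ Δ(E₀)`, `ℓ ∤ c₄(E₀)`, `ℓᵉ ‖ Δ(E₀)`, `p ∤ e` ⟹
  `Ram W p` (the cell's (ram) predicate, `padicValInt ℓ Δ_min = e`);
* `hasIrreducibleModPGaloisRep_of_intModel_of_noroot` — **Frobenius certificate for `Irr`**: a good
  prime `ℓ ∤ Δ(E₀)`, `ℓ ≠ p`, with `#(E₀ mod ℓ)(𝔽_ℓ) = n` and `X² − (ℓ + 1 − n)X + ℓ` root-free
  mod `p` ⟹ `E[p]` irreducible (a `Γ_ℚ`-stable line has an isogeny character `r` with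
  `r(φ_ℓ)² − a_ℓ r(φ_ℓ) + ℓ = 0` in `𝔽_p`, Mazur 1978 Prop. 6.3 (1); tree:
  `Mazur1978.not_hasIrreducibleModPGaloisRep_iff_exists_natCard_eq`, `exists_isogenyCharacter`,
  `isogenyCharacter_sq_sub_frobeniusTrace_mul_add_eq_zero`).

References: J. H. Silverman, *AEC* (2009) VII.5 Prop. 5.1, VIII.8 [SilvermanAEC2009]; B. Mazur,
Invent. Math. 44 (1978) §5, Prop. 6.3 (1) [Mazur1978]; Skinner–Urban 2014 Thm. 2 (the (ram)
hypothesis) [SkinnerUrban2014].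
-/

set_option linter.dupNamespace false
set_option autoImplicit false

noncomputable section

open scoped Classical

open IsDedekindDomain NumberField Rat.HeightOneSpectrum WeierstrassCurve Polynomial
  Literature.NumberTheory.EllipticCurves Literature.NumberTheory.EllipticCurves.Rank1Residual
  Literature.NumberTheory.GaloisRepresentations

namespace Summit.BirchSwinnertonDyer.BirchSwinnertonDyer.Rank1Residual.IntModel

/-! ### The integral model of a literal integer equation -/

/-- For a globally minimal `W / ℚ` that IS the image of an integer equation `E₀`, the tree's integral
model `integralModelInt W` is `E₀` (uniqueness of lifts along `ℤ ↪ ℚ`; Silverman *AEC* VIII.8). [folklore] -/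
theorem integralModelInt_eq_of_map_eq {W : WeierstrassCurve ℚ} [W.IsGloballyMinimal]
    (E₀ : WeierstrassCurve ℤ) (h : E₀.map (Int.castRingHom ℚ) = W) : integralModelInt W = E₀ := by
  apply WeierstrassCurve.map_injective (f := Int.castRingHom ℚ) Int.cast_injective
  show (integralModelInt W).map (Int.castRingHom ℚ) = E₀.map (Int.castRingHom ℚ)
  rw [map_integralModelInt, h]

/-- The integer equation `[a₁, a₂, a₃, a₄, a₆]` maps to the rational one. [folklore] -/
theorem map_mk_int (a1 a2 a3 a4 a6 : ℤ) :
    (⟨a1, a2, a3, a4, a6⟩ : WeierstrassCurve ℤ).map (Int.castRingHom ℚ) =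
      (⟨a1, a2, a3, a4, a6⟩ : WeierstrassCurve ℚ) := by
  ext <;> simp [WeierstrassCurve.map]

/-! ### Two arithmetic helpers -/

/-- `ord_ℓ n = e` from `ℓᵉ ∣ n` and `ℓᵉ⁺¹ ∤ n`. [folklore] -/
theorem padicValInt_eq_of_dvd_of_not_dvd (ℓ : ℕ) [Fact ℓ.Prime] {n : ℤ} {e : ℕ}
    (he : (ℓ : ℤ) ^ e ∣ n) (he' : ¬ (ℓ : ℤ) ^ (e + 1) ∣ n) : padicValInt ℓ n = e := by
  have hn : n ≠ 0 := fun h ↦ he' (h ▸ dvd_zero _)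
  have h1 : e ≤ padicValInt ℓ n := ((padicValInt_dvd_iff e n).mp he).resolve_left hn
  have h2 : ¬ e + 1 ≤ padicValInt ℓ n := fun h ↦ he' ((padicValInt_dvd_iff (e + 1) n).mpr (Or.inr h))
  omega

/-- The node-tangent quadratic of `E₀` mod `p` has degree `2` when `p ∤ c₄(E₀)`. [folklore] -/
theorem degree_nodal_eq_two (E₀ : WeierstrassCurve ℤ) (p : ℕ) [Fact p.Prime] (hc₄ : ¬ (p : ℤ) ∣ E₀.c₄) :
    (letI I := E₀.map (Int.castRingHom (ZMod p));
      (C I.c₄ * X ^ 2 + C (I.a₁ * I.c₄) * X - C (54 * I.b₆ - 3 * I.b₂ * I.b₄ + I.a₂ * I.c₄)).degree) = 2 := by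
  have hc : (E₀.map (Int.castRingHom (ZMod p))).c₄ ≠ 0 := by
    rw [map_c₄, eq_intCast, Ne, ZMod.intCast_zmod_eq_zero_iff_dvd]
    exact hc₄
  rw [sub_eq_add_neg, ← C_neg]
  exact degree_quadratic hc

section

variable {W : WeierstrassCurve ℚ} [W.IsElliptic] [W.IsGloballyMinimal] {E₀ : WeierstrassCurve ℤ}
  (hI : integralModelInt W = E₀)
include hI

omit [W.IsElliptic] in
/-- `Δ_min(W) = Δ(E₀)`. [folklore] -/
theorem minimalDiscriminantInt_eq : minimalDiscriminantInt W = E₀.Δ := by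
  rw [minimalDiscriminantInt, hI]

omit [W.IsElliptic] in
/-- `Δ(W) = Δ(E₀)` in `ℚ`. [folklore] -/
theorem Δ_eq_cast : W.Δ = (E₀.Δ : ℚ) := by
  rw [← cast_minimalDiscriminantInt W, minimalDiscriminantInt_eq hI]

omit [W.IsElliptic] in
/-- `c₄(W) = c₄(E₀)` in `ℚ`. [folklore] -/
theorem c₄_eq_cast : W.c₄ = (E₀.c₄ : ℚ) := by
  conv_lhs => rw [← map_integralModelInt W]
  rw [map_c₄, eq_intCast, hI]

omit [W.IsElliptic] in
/-- `a_ℓ(W) = ℓ + 1 − #(E₀ mod ℓ)(𝔽_ℓ)`. [folklore] -/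
theorem frobeniusTrace_eq {ℓ n : ℕ}
    (hcard : Nat.card ((E₀.map (Int.castRingHom (ZMod ℓ))).toAffine.Point) = n) :
    W.frobeniusTrace ℓ = (ℓ : ℤ) + 1 - n := by
  rw [WeierstrassCurve.frobeniusTrace, WeierstrassCurve.reductionPointCount, hI, hcard]

/-! ### Multiplicative reduction at `p` -/

/-- **`Mult W p` from the integer model**: `p ∣ Δ(E₀)` and `p ∤ c₄(E₀)` for the globally minimal
`W` with integral model `E₀` give multiplicative reduction at `p` (Silverman *AEC* VII.5.1(b)).
[cite: SilvermanAEC2009, VII.5 Prop. 5.1(b)] -/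
theorem hasMultiplicativeReductionAtPrime_of_intModel (p : ℕ) [hp : Fact p.Prime]
    (hΔ : (p : ℤ) ∣ E₀.Δ) (hc₄ : ¬ (p : ℤ) ∣ E₀.c₄) : W.HasMultiplicativeReductionAtPrime p := by
  set v : HeightOneSpectrum (𝓞 ℚ) := (primesEquiv (R := 𝓞 ℚ)).symm ⟨p, hp.out⟩ with hvdef
  have hv : primesEquiv v = ⟨p, hp.out⟩ := Equiv.apply_symm_apply _ _
  have hAt : W.HasMultiplicativeReductionAt v := by
    refine W.hasMultiplicativeReductionAt_of_dvd_of_not_dvd v ?_ ?_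
    · rw [hv, minimalDiscriminantInt_eq hI]; exact hΔ
    · rw [hv, hI]; exact hc₄
  have key : ∀ q : Nat.Primes, primesEquiv v = q →
      (haveI := Fact.mk q.2; W.HasMultiplicativeReductionAtPrime (q : ℕ)) := by
    rintro q rfl
    exact (hasMultiplicativeReductionAtPrime_iff_hasMultiplicativeReductionAt_ringOfIntegers W v).mpr
      hAt
  exact key ⟨p, hp.out⟩ hv

/-! ### Split versus non-split at `p`: a root of the node-tangent quadratic mod `p` -/

/-- The place-indexed criterion of the tree, moved to the prime `p` and the model `E₀`: split
multiplicative at `p` iff the node-tangent quadratic of `E₀` mod `p` splits. [cite: SilvermanAEC2009, VII.5 Prop. 5.1(b)] -/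
theorem hasSplitMultiplicativeReductionAtPrime_iff_splits (p : ℕ) [hp : Fact p.Prime]
    (hΔ : (p : ℤ) ∣ E₀.Δ) (hc₄ : ¬ (p : ℤ) ∣ E₀.c₄) :
    W.HasSplitMultiplicativeReductionAtPrime p ↔
      (letI I := E₀.map (Int.castRingHom (ZMod p));
        (C I.c₄ * X ^ 2 + C (I.a₁ * I.c₄) * X - C (54 * I.b₆ - 3 * I.b₂ * I.b₄ + I.a₂ * I.c₄)).Splits) := by
  set v : HeightOneSpectrum (𝓞 ℚ) := (primesEquiv (R := 𝓞 ℚ)).symm ⟨p, hp.out⟩ with hvdef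
  have hv : primesEquiv v = ⟨p, hp.out⟩ := Equiv.apply_symm_apply _ _
  have hΔ' : ((primesEquiv v : ℕ) : ℤ) ∣ minimalDiscriminantInt W := by
    rw [hv, minimalDiscriminantInt_eq hI]; exact hΔ
  have hc₄' : ¬ ((primesEquiv v : ℕ) : ℤ) ∣ (integralModelInt W).c₄ := by
    rw [hv, hI]; exact hc₄
  have h1 := W.hasSplitMultiplicativeReductionAt_iff_splits v hΔ' hc₄'
  have h2 := hasSplitMultiplicativeReductionAtPrime_iff_hasSplitMultiplicativeReductionAt W v
  have key : ∀ q : Nat.Primes, primesEquiv v = q →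
      ((haveI := Fact.mk q.2; W.HasSplitMultiplicativeReductionAtPrime (q : ℕ)) ↔
        (letI I := (integralModelInt W).map (Int.castRingHom (ZMod q));
          (C I.c₄ * X ^ 2 + C (I.a₁ * I.c₄) * X
            - C (54 * I.b₆ - 3 * I.b₂ * I.b₄ + I.a₂ * I.c₄)).Splits)) := by
    rintro q rfl
    exact h2.trans h1
  have h3 := key ⟨p, hp.out⟩ hv
  rw [hI] at h3
  exact h3

/-- **Split multiplicative at `p` from a root** of the node-tangent quadratic of `E₀` mod `p`
(`p ∣ Δ(E₀)`, `p ∤ c₄(E₀)`): a quadratic with a root splits. [cite: SilvermanAEC2009, VII.5 Prop. 5.1(b)] -/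
theorem hasSplitMultiplicativeReductionAtPrime_of_intModel_of_root (p : ℕ) [hp : Fact p.Prime]
    (hΔ : (p : ℤ) ∣ E₀.Δ) (hc₄ : ¬ (p : ℤ) ∣ E₀.c₄)
    (hroot : ∃ t : ZMod p, (E₀.c₄ : ZMod p) * t ^ 2 + (E₀.a₁ * E₀.c₄ : ZMod p) * t
      - (54 * E₀.b₆ - 3 * E₀.b₂ * E₀.b₄ + E₀.a₂ * E₀.c₄ : ZMod p) = 0) :
    W.HasSplitMultiplicativeReductionAtPrime p := by
  rw [hasSplitMultiplicativeReductionAtPrime_iff_splits hI p hΔ hc₄]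
  obtain ⟨t, ht⟩ := hroot
  refine Splits.of_degree_eq_two (degree_nodal_eq_two E₀ p hc₄) (x := t) ?_
  simp only [eval_sub, eval_add, eval_mul, eval_C, eval_X, eval_pow, map_c₄, map_b₂, map_b₄,
    map_b₆, map_a₁, map_a₂, eq_intCast]
  linear_combination ht

/-- **Non-split multiplicative at `p` from root-freeness** of the node-tangent quadratic of `E₀`
mod `p` (`p ∣ Δ(E₀)`, `p ∤ c₄(E₀)`): a splitting quadratic has a root. [cite: SilvermanAEC2009, VII.5 Prop. 5.1(b)] -/
theorem not_hasSplitMultiplicativeReductionAtPrime_of_intModel_of_noroot (p : ℕ) [hp : Fact p.Prime]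
    (hΔ : (p : ℤ) ∣ E₀.Δ) (hc₄ : ¬ (p : ℤ) ∣ E₀.c₄)
    (hnoroot : ∀ t : ZMod p, (E₀.c₄ : ZMod p) * t ^ 2 + (E₀.a₁ * E₀.c₄ : ZMod p) * t
      - (54 * E₀.b₆ - 3 * E₀.b₂ * E₀.b₄ + E₀.a₂ * E₀.c₄ : ZMod p) ≠ 0) :
    ¬ W.HasSplitMultiplicativeReductionAtPrime p := by
  rw [hasSplitMultiplicativeReductionAtPrime_iff_splits hI p hΔ hc₄]
  intro hs
  obtain ⟨t, ht⟩ := hs.exists_eval_eq_zero (by rw [degree_nodal_eq_two E₀ p hc₄]; decide)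
  refine hnoroot t ?_
  simp only [eval_sub, eval_add, eval_mul, eval_C, eval_X, eval_pow, map_c₄, map_b₂, map_b₄,
    map_b₆, map_a₁, map_a₂, eq_intCast] at ht
  linear_combination ht

/-! ### Non-semistability: an additive prime -/

/-- **`¬ Semistable W` from the integer model**: a prime `q` with `q ∣ Δ(E₀)` and `q ∣ c₄(E₀)` is a
prime of additive reduction of the globally minimal `W` (Silverman *AEC* VII.5.1(c)), so `W` is not
semistable. [cite: SilvermanAEC2009, VII.5 Prop. 5.1(c)] -/
theorem not_semistable_of_intModel (q : ℕ) (hq : q.Prime) (hΔ : (q : ℤ) ∣ E₀.Δ)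
    (hc₄ : (q : ℤ) ∣ E₀.c₄) : ¬ Semistable W := by
  intro hs
  set v : HeightOneSpectrum (𝓞 ℚ) := (primesEquiv (R := 𝓞 ℚ)).symm ⟨q, hq⟩ with hvdef
  have hv : primesEquiv v = ⟨q, hq⟩ := Equiv.apply_symm_apply _ _
  haveI : Fact (primesEquiv v : ℕ).Prime := ⟨(primesEquiv v).2⟩
  have hadd : W.HasAdditiveReductionAt v := by
    rw [hasAdditiveReductionAt_iff_of_isMinimalAt (IsGloballyMinimal.isMinimal (W := W) v),
      Δ_eq_cast hI, c₄_eq_cast hI, (valuation_equiv_padicValuation v).lt_one_iff_lt_one,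
      (valuation_equiv_padicValuation v).lt_one_iff_lt_one, Rat.padicValuation_cast,
      Rat.padicValuation_cast, Int.padicValuation_lt_one_iff, Int.padicValuation_lt_one_iff, hv]
    exact ⟨hΔ, hc₄⟩
  have key : ∀ q' : Nat.Primes, primesEquiv v = q' →
      (haveI := Fact.mk q'.2;
        W.HasGoodReductionAtPrime (q' : ℕ) ∨ W.HasMultiplicativeReductionAtPrime (q' : ℕ)) →
      W.HasGoodReductionAt v ∨ W.HasMultiplicativeReductionAt v := by
    rintro q' rfl h
    rcases h with h | h
    · exact Or.inl ((hasGoodReductionAtPrime_iff_hasGoodReductionAt_ringOfIntegers v W).mp h)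
    · exact Or.inr
        ((hasMultiplicativeReductionAtPrime_iff_hasMultiplicativeReductionAt_ringOfIntegers W v).mp h)
  rcases key ⟨q, hq⟩ hv (hs q hq) with hg | hm
  · exact hadd.not_hasGoodReductionAt hg
  · exact hadd.not_hasMultiplicativeReductionAt hm

/-! ### The (ram) witness -/

/-- **`Ram W p` from the integer model**: a prime `ℓ ≠ p` with `ℓ ∣ Δ(E₀)`, `ℓ ∤ c₄(E₀)`
(multiplicative at `ℓ`) and `ℓᵉ ‖ Δ(E₀) = Δ_min` with `p ∤ e` is a (ram) witness (Skinner–Urban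
2014 Thm. 2, hypothesis (ram): `ρ̄_{E,p}` ramified at the multiplicative prime `ℓ`, equivalently
`p ∤ ord_ℓ Δ_min`). [cite: SkinnerUrban2014, Thm. 2 (p. 3), second bullet] [cite: SilvermanAEC2009, VII.5 Prop. 5.1(b)] -/
theorem ram_of_intModel (p ℓ : ℕ) [Fact p.Prime] (hℓ : ℓ.Prime) (hℓp : ℓ ≠ p)
    (hΔ : (ℓ : ℤ) ∣ E₀.Δ) (hc₄ : ¬ (ℓ : ℤ) ∣ E₀.c₄) {e : ℕ} (he : (ℓ : ℤ) ^ e ∣ E₀.Δ)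
    (he' : ¬ (ℓ : ℤ) ^ (e + 1) ∣ E₀.Δ) (hpe : ¬ p ∣ e) : Ram W p := by
  haveI : Fact ℓ.Prime := ⟨hℓ⟩
  refine ⟨ℓ, ⟨hℓ⟩, hℓp, hasMultiplicativeReductionAtPrime_of_intModel hI ℓ hΔ hc₄, ?_⟩
  rw [minimalDiscriminantInt_eq hI, padicValInt_eq_of_dvd_of_not_dvd ℓ he he']
  exact hpe

/-! ### Irreducibility of `E[p]` from a Frobenius witness -/

/-- **`E[p]` irreducible from a Frobenius witness** (Mazur 1978, Prop. 6.3 (1)): for the globally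
minimal `W` with integral model `E₀`, a prime `ℓ ∤ Δ(E₀)` (good reduction), `ℓ ≠ p`, with
`#(E₀ mod ℓ)(𝔽_ℓ) = n` and `X² − (ℓ + 1 − n)X + ℓ` WITHOUT a root in `ℤ/p` force `E[p]` to be an
irreducible `Γ_ℚ`-module: otherwise a `Γ_ℚ`-stable line `⟨P⟩ ⊂ E[p]` carries an isogeny character
`r` (Mazur §5) and `r(φ)² − a_ℓ r(φ) + ℓ = 0` in `𝔽_p` at an arithmetic Frobenius `φ` above `ℓ`.
[cite: Mazur1978, §5 (p. 148) and §6 Prop. 6.3 (1) (p. 153)] -/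
theorem hasIrreducibleModPGaloisRep_of_intModel_of_noroot (p ℓ : ℕ) [hp : Fact p.Prime]
    [hℓ : Fact ℓ.Prime] (hℓp : ℓ ≠ p) (hℓΔ : ¬ (ℓ : ℤ) ∣ E₀.Δ) {n : ℕ}
    (hcard : Nat.card ((E₀.map (Int.castRingHom (ZMod ℓ))).toAffine.Point) = n)
    (hnoroot : ∀ t : ZMod p, t ^ 2 - (((ℓ : ℤ) + 1 - n : ℤ) : ZMod p) * t + (ℓ : ZMod p) ≠ 0) :
    W.HasIrreducibleModPGaloisRep p := by
  have hpp : p.Prime := hp.out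
  haveI : NeZero (p : ℚ) := ⟨Nat.cast_ne_zero.mpr hpp.ne_zero⟩
  have hgood : W.HasGoodReductionAtPrime ℓ :=
    hasGoodReductionAtPrime_of_not_dvd W ℓ (by rw [minimalDiscriminantInt_eq hI]; exact hℓΔ)
  have htr : W.frobeniusTrace ℓ = (ℓ : ℤ) + 1 - n := frobeniusTrace_eq hI hcard
  by_contra hred
  obtain ⟨H, hHstab, hHcard⟩ :=
    (Mazur1978.not_hasIrreducibleModPGaloisRep_iff_exists_natCard_eq W p).mp hred
  obtain ⟨P, hP0, hHP⟩ := Mazur1978.exists_eq_zmultiples_of_natCard_eq W p hHcard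
  have hst : ∀ σ : Field.absoluteGaloisGroup ℚ, σ • P ∈ AddSubgroup.zmultiples P := fun σ ↦ by
    rw [← hHP]; exact hHstab σ P (hHP ▸ AddSubgroup.mem_zmultiples P)
  obtain ⟨r, hr⟩ := Mazur1978.exists_isogenyCharacter W p hP0 hst
  set v : HeightOneSpectrum (𝓞 ℚ) := (primesEquiv (R := 𝓞 ℚ)).symm ⟨ℓ, hℓ.out⟩ with hvdef
  have hvℓ : (primesEquiv v : ℕ) = ℓ := by rw [hvdef, Equiv.apply_symm_apply]
  have hv : (ℓ : 𝓞 ℚ) ∈ v.asIdeal := by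
    rw [DeuringLadic.natCast_mem_asIdeal_iff v ℓ, hvℓ]
  obtain ⟨𝔓, h𝔓⟩ := v.primesAbove_nonempty
  obtain ⟨φ, hφ⟩ := HeightOneSpectrum.exists_isArithFrobAt_of_mem_primesAbove_holds (v := v) h𝔓
  have key := Mazur1978.isogenyCharacter_sq_sub_frobeniusTrace_mul_add_eq_zero W p ℓ hℓp hgood hP0
    hr hv h𝔓 hφ
  rw [htr] at key
  exact hnoroot _ key

end

end Summit.BirchSwinnertonDyer.BirchSwinnertonDyer.Rank1Residual.IntModel

end
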